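import Summits.BirchSwinnertonDyer.BirchSwinnertonDyer.Theorems.PrintCf2RubinValueTwoKatzMeasureJZeroSeamTateUnitOfLane
import Literature.NumberTheory.EllipticCurves.CMDeltaDatumReading
import Literature.NumberTheory.NumberFields.RayClassFieldAdicCharacterPrincipal
import HarnessLib

/-!
# [I4] AT THE LANE WITH PRINT-SHAPED INPUTS: the Tate units of two levels differ by `δ_v`, from `𝔓`-integral readings only;
# the level constant `A_M = φ_F(a_M)·Φ(μ_M)` is level-independent (TATE-UNIT-CM / OQ-A1 of the `j = 0` seam; proofs only)

Cell `bsd-print-cf2`, width seat `bsd-line-cf2c-w4` g16.  The COMPOSITION of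
`Literature.NumberTheory.EllipticCurves.exists_deltaDatum_readingRing` (the `δ`-CM datum over `R := readingRing E hE_r`) with
`tateUnit_eq_mul_of_lane` (`SeamTateUnitOfLane`): every hypothesis of the `R`-block of the latter (`ψ j α_R c T P_C Q_C P_r Q_r s`, the series
identities, the base-point readings over `R`) is DISCHARGED, the representatives of `δ⁻¹Λ/Λ` are chosen inside
(`PeriodPair.exists_reps_of_mul_mem`), the CM-stability / non-membership side conditions follow from the two presentations
`Λ = Ω·ι(𝔪) = Ω′·ι(𝔪′)` (`DeShalitDivisionPointsLattice`), and the unit `c = δ_v ∈ 𝒪_vˣ` with `e(c) = e_K(δ)` is CONSTRUCTED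
(`exists_tateUnit_reading_of_not_mem`, from `NumberFields.integerUnit` and `coe_padicIntEquivOfDegreeOne_apply`).  What remains are
PRINT-SHAPED inputs: four `𝔓`-integral coordinates `X₀ Y₀ X₁ Y₁ ∈ K(𝔪_r)` of `ξ(Ω′)`, `ξ(Ω)` and, for every `δ`-torsion argument `c′`, a
`𝔓`-integral `X ∈ K(𝔪_r)` reading `℘(c′) − b₂/12` (clause (vi) of the fifth print, II.1.5, and the integrality II.4.9 (i)).

* §1 `exists_tateUnit_reading_of_not_mem` — `δ ∉ v ⇒ ∃ c ∈ 𝒪_vˣ, c = δ_v ∧ e(c) = e_K(δ_v)` (`e = (𝒪[K_v] ≃ 𝒪_v) ≫ (𝒪_v ≃ ℤ₂)`).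
* §2 ★★★ `tateUnit_eq_mul_of_lane_of_torsionReadings` — **`∃ c ∈ 𝒪_vˣ, c = δ_v ∧ a = c·a′`**.
* §3 `levelConstant_eq_of_tateUnit_eq_mul` — the bookkeeping `a = c·a′`, `c = δ_v`, `μ′ = δ·μ`, `φ_F|_K = Φ` ⇒
  `φ_F(a)·Φ(μ) = φ_F(a′)·Φ(μ′)` over any commutative ring (the level constant `A_M := φ_F(a_M)·ι⁻¹(w₀ μ_M)` of the seam values is
  level-independent).

No summit statement is proved; BSD is not proved by any of this.

## References
* [deShalit1987] E. de Shalit, *Iwasawa theory of elliptic curves with complex multiplication* (1987), II §1.5 (15), II §1.10 Lemma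
  (p. 39), II §4.3 (p. 57), II §4.4 (iv), II §4.9 Proposition (i)(ii) (p. 62–63), II §4.14 (38).
* [LubinTate1965] J. Lubin, J. Tate, *Formal complex multiplication in local fields* (1965), §1 Thm. 1.
* [FrohlichTaylor1990] A. Fröhlich, M. J. Taylor, *Algebraic Number Theory* (1991), Ch. III §1 (1.14)(a).
-/

-- the summit namespace `Summit.BirchSwinnertonDyer.BirchSwinnertonDyer` repeats the problem name by design (D-0017)
set_option linter.dupNamespace false
set_option autoImplicit false

noncomputable section

open scoped Classical
open scoped NumberField
open PeriodPair Literature.NumberTheory.EllipticCurves Literature.NumberTheory.EllipticCurves.DeShalit1987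
open Literature.NumberTheory.ComplexMultiplication.EllipticUnits
open NumberField Field IsDedekindDomain IsDedekindDomain.HeightOneSpectrum ValuativeRel PowerSeries
open Literature.NumberTheory.NumberFields
open Literature.NumberTheory.GaloisRepresentations Literature.NumberTheory.GaloisRepresentations.IsNonarchimedeanLocalField
  Literature.NumberTheory.GaloisRepresentations.LubinTate Literature.NumberTheory.EllipticCurves.FormalGroupChart _root_.WeierstrassCurve

namespace Summit.BirchSwinnertonDyer.BirchSwinnertonDyer.Theorems.PrintCf2.KatzMeasureJZeroSeam

attribute [local instance] ltNormUniformSpace ltNormIsUniformAddGroup rk1 nF nE fintypeResidueField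

variable {K : Type} [Field K] [NumberField K] {𝔪 𝔪' : Ideal (𝓞 K)} {v : HeightOneSpectrum (𝓞 K)}

/-! ## §1 The unit `δ_v ∈ 𝒪_vˣ` and its `2`-adic reading -/

/-- **`δ ∉ v ⇒ δ_v ∈ 𝒪_vˣ` with `e(δ_v) = e_K(δ)`**: for `δ ∈ 𝓞_K` prime to the degree-one place `v ∣ 2` there is a unit `c` of
`𝒪[K_v]` equal to `δ` in `K_v` whose image under `e = (𝒪[K_v] ≃ 𝒪_v) ≫ (𝒪_v ≃ ℤ₂)` is, in `ℚ₂`, the image of `δ` under `K_v ≃ ℚ₂` —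
the hypotheses `c`, `hce`, `hcδ` of `exists_deltaDatum_readingRing`. [cite: FrohlichTaylor1990, Ch. III §1 (1.14)(a)]
[cite: deShalit1987, II §4.9 (ii)] -/
theorem exists_tateUnit_reading_of_not_mem [v.asIdeal.LiesOver (ratPlace 2).asIdeal]
    (he : v.asIdeal.ramificationIdx (𝓞 ℚ) = 1) (hf : v.asIdeal.inertiaDeg (𝓞 ℚ) = 1) {δ : 𝓞 K} (hδv : δ ∉ v.asIdeal) :
    ∃ c : 𝒪[(v.adicCompletion K)]ˣ,
      ((c : 𝒪[(v.adicCompletion K)]) : v.adicCompletion K) = algebraMap K (v.adicCompletion K) (δ : K) ∧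
      ((((integerEquivAdicCompletionIntegers v).trans (padicIntEquivOfDegreeOne K 2 v he hf)) (c : 𝒪[(v.adicCompletion K)]) : ℤ_[2]) :
          ℚ_[2]) = padicEquivOfDegreeOne K 2 v he hf (algebraMap K (v.adicCompletion K) (δ : K)) := by
  refine ⟨Units.map ((integerEquivAdicCompletionIntegers v).symm : v.adicCompletionIntegers K →* 𝒪[(v.adicCompletion K)])
    (integerUnit v δ hδv), rfl, ?_⟩
  rw [Units.coe_map, MonoidHom.coe_coe, RingEquiv.trans_apply, RingEquiv.apply_symm_apply, coe_padicIntEquivOfDegreeOne_apply]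
  rfl

/-! ## §2 TATE-UNIT-CM at the lane from `𝔓`-integral readings -/

/-- ★★★ **TATE-UNIT-CM at `K_v` from PRINT-SHAPED inputs** (see the module docstring): for two presentations `Λ = Ω·ι(𝔪) = Ω′·ι(𝔪′)`
of the model lattice (`𝔪′ ≤ 𝔪`, `Ω = ι(δ)Ω′`, `δ ∉ v`, `2 ∉ 𝔪`), the OUTPUT of `SeamBridgeOfLane` at the two levels (`xu yu XU YU a ha` and
primed) and `𝔓`-INTEGRAL readings in `K(𝔪_r)` (`e(K(𝔪_r)) ⊆ E`) of `ξ(Ω′)`, `ξ(Ω)` and of the `δ`-torsion x-coordinates: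
**`∃ c ∈ 𝒪_vˣ, c = δ_v ∧ a = c·a′`** (`exists_deltaDatum_readingRing` → `tateUnit_eq_mul_of_lane`). [cite: deShalit1987, II §1.5 (15), II §1.10 Lemma, II §4.3, II §4.4 (iv), II §4.9 (i)(ii)] [cite: LubinTate1965, §1 Thm. 1] -/
theorem tateUnit_eq_mul_of_lane_of_torsionReadings [IsTotallyComplex K] [v.asIdeal.LiesOver (ratPlace 2).asIdeal]
    (he : v.asIdeal.ramificationIdx (𝓞 ℚ) = 1) (hf : v.asIdeal.inertiaDeg (𝓞 ℚ) = 1)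
    -- the lane at `K_v`: `e = (𝒪[K_v] ≃ 𝒪_v) ≫ (𝒪_v ≃ ℤ₂)`, `e π = π_ℤ`, `P = [π_ℤ] = exp_W(π_ℤ·log_W)` on `[1,−1,0,−2,−1]`
    (e : 𝒪[(v.adicCompletion K)] ≃+* ℤ_[2]) (hee : e = (integerEquivAdicCompletionIntegers v).trans (padicIntEquivOfDegreeOne K 2 v he hf))
    (hq : residueFieldCard (v.adicCompletion K) = 2)
    {π : 𝒪[(v.adicCompletion K)]} (hπ : (valuation (v.adicCompletion K)).IsUniformizer (π : (v.adicCompletion K)))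
    {πZ : ℤ_[2]} (heπ : e π = πZ) (hA : IsLTRing πZ 2) {P : PowerSeries ℤ_[2]} (hP : IsLTSeries πZ 2 P)
    (hPexp : P.map PadicInt.Coe.ringHom =
      ((⟨1, -1, 0, -2, -1⟩ : WeierstrassCurve ℤ_[2]).map PadicInt.Coe.ringHom).formalExp.subst
        (C (πZ : ℚ_[2]) * ((⟨1, -1, 0, -2, -1⟩ : WeierstrassCurve ℤ_[2]).map PadicInt.Coe.ringHom).formalLog))
    (W : WeierstrassCurve ℤ) (hW : W = ⟨1, -1, 0, -2, -1⟩)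
    (E : IntermediateField (v.adicCompletion K) (AlgebraicClosure (v.adicCompletion K)))
    [FiniteDimensional (v.adicCompletion K) E] [Normal (v.adicCompletion K) E]
    [hEll : ∀ n : ℕ, (curveOver (E ⊔ ltField π n : IntermediateField (v.adicCompletion K) (AlgebraicClosure (v.adicCompletion K)))
      ((W.map (Int.castRingHom ℤ_[2])).map ((LTCoeff.of (v.adicCompletion K)).toRingHom.comp e.symm.toRingHom))).IsElliptic]
    -- the model lattice, two presentations `L = Ω·ι(𝔪) = Ω′·ι(𝔪′)`, `𝔪′ ≤ 𝔪`, `Ω = ι(δ)Ω′` with `δ ∉ v`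
    (ι : K →+* ℂ) (L : PeriodPair) (h₂ : L.g₂ = (W.baseChange ℂ).c₄ / 12) (h₃ : L.g₃ = (W.baseChange ℂ).c₆ / 216)
    {Ω Ω' : ℂ} (hL : ∀ z : ℂ, z ∈ L.lattice ↔ ∃ a ∈ 𝔪, z = Ω * ι (a : K)) (hL' : ∀ z : ℂ, z ∈ L.lattice ↔ ∃ a ∈ 𝔪', z = Ω' * ι (a : K))
    (hle : 𝔪' ≤ 𝔪) {δ β β' π₀ π₁ : 𝓞 K} (hδv : δ ∉ v.asIdeal) (hΩ' : Ω' ≠ 0) (hΩδ : Ω = ι (δ : K) * Ω')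
    (hβ : β * π₀ - 1 ∈ 𝔪) (hβ' : β' * π₀ - 1 ∈ 𝔪')
    -- the split prime; `π₀ᵏ ∉ 𝔪, 𝔪′`, `2 ∉ 𝔪`
    (hv0 : v.asIdeal = Ideal.span {π₀}) (h2K : (2 : 𝓞 K) = π₀ * π₁) (hprime : Prime π₀) (hπ₁ : ¬ π₀ ∣ π₁)
    (hπ₀𝔪 : ∀ k : ℕ, (π₀ ^ k : 𝓞 K) ∉ 𝔪) (hπ₀𝔪' : ∀ k : ℕ, (π₀ ^ k : 𝓞 K) ∉ 𝔪')
    (h2𝔪 : (2 : 𝓞 K) ∉ 𝔪)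
    -- the reading level `K(𝔪_r)` read into `E`, and the `𝔓`-INTEGRAL READINGS of `ξ(Ω′)`, `ξ(Ω)` and of the `δ`-torsion x-coordinates
    {𝔪r : Ideal (𝓞 K)} (hEr : ∀ y : AlgebraicClosure K, y ∈ rayClassField K 𝔪r → absClosureEmbedding K (v.adicCompletion K) y ∈ E)
    (X₀ Y₀ X₁ Y₁ : rayClassField K 𝔪r)
    (hX₀ : algClosureEmb ι X₀ = ℘[L] Ω' - (W.baseChange ℂ).b₂ / 12)
    (hY₀ : algClosureEmb ι Y₀ = (℘'[L] Ω' - (W.baseChange ℂ).a₁ * (℘[L] Ω' - (W.baseChange ℂ).b₂ / 12) - (W.baseChange ℂ).a₃) / 2)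
    (hX₁ : algClosureEmb ι X₁ = ℘[L] Ω - (W.baseChange ℂ).b₂ / 12)
    (hY₁ : algClosureEmb ι Y₁ = (℘'[L] Ω - (W.baseChange ℂ).a₁ * (℘[L] Ω - (W.baseChange ℂ).b₂ / 12) - (W.baseChange ℂ).a₃) / 2)
    (hX₀i : X₀ ∈ readingRing E hEr) (hY₀i : Y₀ ∈ readingRing E hEr) (hX₁i : X₁ ∈ readingRing E hEr) (hY₁i : Y₁ ∈ readingRing E hEr)
    (hXδ : ∀ c' : ℂ, ι (δ : K) * c' ∈ L.lattice → c' ∉ L.lattice →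
      ∃ X : rayClassField K 𝔪r, X ∈ readingRing E hEr ∧ algClosureEmb ι X = ℘[L] c' - (W.baseChange ℂ).b₂ / 12)
    -- clause (vi) of the fifth print and the reading modulus `𝔑 ≤ 𝔣ψ·𝔪′` of `E` (for the auxiliary readings)
    {𝔣ψ : Ideal (𝓞 K)}
    (h6 : ∀ 𝔠 : Ideal (𝓞 K), 𝔠 ≠ ⊥ → ∀ z : ℂ, z ∈ idealInvLattice ι 𝔠 L.lattice → z ∉ L.lattice →
      ∃ x y : rayClassField K (𝔣ψ * 𝔠), algClosureEmb ι x = ℘[L] z ∧ algClosureEmb ι y = ℘'[L] z)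
    {𝔑 : Ideal (𝓞 K)} (h𝔑 : 𝔑 ≠ ⊥) (hv𝔑 : ¬ 𝔑 ≤ v.asIdeal) (h𝔑ψ : 𝔑 ≤ 𝔣ψ * 𝔪')
    {α : 𝓞 K} (hα0 : α ≠ 0) (hα𝔑 : α - 1 ∈ 𝔑) (hαw : ∀ w : HeightOneSpectrum (𝓞 K), w ≠ v → α ∉ w.asIdeal)
    {f : ℕ} (hαπ : ((α : K) : v.adicCompletion K) = (π : v.adicCompletion K) ^ f)
    (hdegE : ∀ w : WeilGroup (v.adicCompletion K),
      WeilGroup.toAbsGalois (v.adicCompletion K) w ∈ E.fixingSubgroup → (f : ℤ) ∣ WeilGroup.deg w)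
    -- the division points of the two presentations, READ (the OUTPUT of `SeamBridgeOfLane` at each level), with their Tate units
    (xu yu xu' yu' : ℕ → AlgebraicClosure K)
    (XU YU XU' YU' : ∀ m : ℕ, ↥(E ⊔ ltField π m : IntermediateField (v.adicCompletion K) (AlgebraicClosure (v.adicCompletion K))))
    (hxu : ∀ m : ℕ, algClosureEmb ι (xu m) =
      ℘[L] (ι ((β ^ (m + 1) : 𝓞 K) : K) * Ω - Ω / ι ((π₀ ^ (m + 1) : 𝓞 K) : K)) - (W.baseChange ℂ).b₂ / 12)
    (hyu : ∀ m : ℕ, algClosureEmb ι (yu m) = (℘'[L] (ι ((β ^ (m + 1) : 𝓞 K) : K) * Ω - Ω / ι ((π₀ ^ (m + 1) : 𝓞 K) : K)) -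
      (W.baseChange ℂ).a₁ * (℘[L] (ι ((β ^ (m + 1) : 𝓞 K) : K) * Ω - Ω / ι ((π₀ ^ (m + 1) : 𝓞 K) : K)) - (W.baseChange ℂ).b₂ / 12) -
      (W.baseChange ℂ).a₃) / 2)
    (hXU : ∀ m, ((XU m : ↥(E ⊔ ltField π m : IntermediateField (v.adicCompletion K) (AlgebraicClosure (v.adicCompletion K)))) :
      AlgebraicClosure (v.adicCompletion K)) = (absClosureEmbedding K (v.adicCompletion K)).toRingHom (xu m))
    (hYU : ∀ m, ((YU m : ↥(E ⊔ ltField π m : IntermediateField (v.adicCompletion K) (AlgebraicClosure (v.adicCompletion K)))) :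
      AlgebraicClosure (v.adicCompletion K)) = (absClosureEmbedding K (v.adicCompletion K)).toRingHom (yu m))
    (hxu' : ∀ m : ℕ, algClosureEmb ι (xu' m) =
      ℘[L] (ι ((β' ^ (m + 1) : 𝓞 K) : K) * Ω' - Ω' / ι ((π₀ ^ (m + 1) : 𝓞 K) : K)) - (W.baseChange ℂ).b₂ / 12)
    (hyu' : ∀ m : ℕ, algClosureEmb ι (yu' m) = (℘'[L] (ι ((β' ^ (m + 1) : 𝓞 K) : K) * Ω' - Ω' / ι ((π₀ ^ (m + 1) : 𝓞 K) : K)) -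
      (W.baseChange ℂ).a₁ * (℘[L] (ι ((β' ^ (m + 1) : 𝓞 K) : K) * Ω' - Ω' / ι ((π₀ ^ (m + 1) : 𝓞 K) : K)) - (W.baseChange ℂ).b₂ / 12) -
      (W.baseChange ℂ).a₃) / 2)
    (hXU' : ∀ m, ((XU' m : ↥(E ⊔ ltField π m : IntermediateField (v.adicCompletion K) (AlgebraicClosure (v.adicCompletion K)))) :
      AlgebraicClosure (v.adicCompletion K)) = (absClosureEmbedding K (v.adicCompletion K)).toRingHom (xu' m))
    (hYU' : ∀ m, ((YU' m : ↥(E ⊔ ltField π m : IntermediateField (v.adicCompletion K) (AlgebraicClosure (v.adicCompletion K)))) :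
      AlgebraicClosure (v.adicCompletion K)) = (absClosureEmbedding K (v.adicCompletion K)).toRingHom (yu' m))
    {a a' : 𝒪[(v.adicCompletion K)]ˣ}
    (ha : ∀ (n : ℕ) (h : (curveOver (E ⊔ ltField π n : IntermediateField (v.adicCompletion K) (AlgebraicClosure (v.adicCompletion K)))
        ((W.map (Int.castRingHom ℤ_[2])).map ((LTCoeff.of (v.adicCompletion K)).toRingHom.comp e.symm.toRingHom))).toAffine.Nonsingular
        (XU n) (YU n)),
      ptOfZ (E ⊔ ltField π n : IntermediateField (v.adicCompletion K) (AlgebraicClosure (v.adicCompletion K)))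
          ((W.map (Int.castRingHom ℤ_[2])).map ((LTCoeff.of (v.adicCompletion K)).toRingHom.comp e.symm.toRingHom))
          (evalPt₁ (maxNilIdeal (v.adicCompletion K) (E ⊔ ltField π n : IntermediateField (v.adicCompletion K)
              (AlgebraicClosure (v.adicCompletion K))))
            (hom (isLTRing_LTCoeff hπ) (isLTSeries_map_LTCoeff_of_degree_one e hq heπ hP) (isLTSeries_LTCoeff π) 1)
            (constantCoeff_hom _ _ _ 1)
            (evalPt₁ (maxNilIdeal (v.adicCompletion K) (E ⊔ ltField π n : IntermediateField (v.adicCompletion K)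
                (AlgebraicClosure (v.adicCompletion K))))
              (hom (isLTRing_LTCoeff hπ) (isLTSeries_LTCoeff π) (isLTSeries_LTCoeff π) (LTCoeff.of (v.adicCompletion K)
                (a : 𝒪[(v.adicCompletion K)])))
              (constantCoeff_hom _ _ _ _)
              (inclPt (le_sup_right : ltField π n ≤ E ⊔ ltField π n) (cohPt hπ n)))) =
        (.some (XU n) (YU n) h : (curveOver (E ⊔ ltField π n : IntermediateField (v.adicCompletion K) (AlgebraicClosure (v.adicCompletion K)))
          ((W.map (Int.castRingHom ℤ_[2])).map ((LTCoeff.of (v.adicCompletion K)).toRingHom.comp e.symm.toRingHom))).toAffine.Point))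
    (ha' : ∀ (n : ℕ) (h : (curveOver (E ⊔ ltField π n : IntermediateField (v.adicCompletion K) (AlgebraicClosure (v.adicCompletion K)))
        ((W.map (Int.castRingHom ℤ_[2])).map ((LTCoeff.of (v.adicCompletion K)).toRingHom.comp e.symm.toRingHom))).toAffine.Nonsingular
        (XU' n) (YU' n)),
      ptOfZ (E ⊔ ltField π n : IntermediateField (v.adicCompletion K) (AlgebraicClosure (v.adicCompletion K)))
          ((W.map (Int.castRingHom ℤ_[2])).map ((LTCoeff.of (v.adicCompletion K)).toRingHom.comp e.symm.toRingHom))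
          (evalPt₁ (maxNilIdeal (v.adicCompletion K) (E ⊔ ltField π n : IntermediateField (v.adicCompletion K)
              (AlgebraicClosure (v.adicCompletion K))))
            (hom (isLTRing_LTCoeff hπ) (isLTSeries_map_LTCoeff_of_degree_one e hq heπ hP) (isLTSeries_LTCoeff π) 1)
            (constantCoeff_hom _ _ _ 1)
            (evalPt₁ (maxNilIdeal (v.adicCompletion K) (E ⊔ ltField π n : IntermediateField (v.adicCompletion K)
                (AlgebraicClosure (v.adicCompletion K))))
              (hom (isLTRing_LTCoeff hπ) (isLTSeries_LTCoeff π) (isLTSeries_LTCoeff π) (LTCoeff.of (v.adicCompletion K)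
                (a' : 𝒪[(v.adicCompletion K)])))
              (constantCoeff_hom _ _ _ _)
              (inclPt (le_sup_right : ltField π n ≤ E ⊔ ltField π n) (cohPt hπ n)))) =
        (.some (XU' n) (YU' n) h : (curveOver (E ⊔ ltField π n : IntermediateField (v.adicCompletion K) (AlgebraicClosure (v.adicCompletion K)))
          ((W.map (Int.castRingHom ℤ_[2])).map ((LTCoeff.of (v.adicCompletion K)).toRingHom.comp e.symm.toRingHom))).toAffine.Point)) :
    ∃ c : 𝒪[(v.adicCompletion K)]ˣ,
      ((c : 𝒪[(v.adicCompletion K)]) : v.adicCompletion K) = algebraMap K (v.adicCompletion K) (δ : K) ∧ a = c * a' := by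
  subst hee
  have hπ₀ : π₀ ≠ 0 := hprime.ne_zero
  have hδ : δ ≠ 0 := by rintro rfl; exact hδv (zero_mem _)
  have hιδ : ι (δ : K) ≠ 0 := (map_ne_zero ι).mpr (by exact_mod_cast hδ)
  have hΩ : Ω ≠ 0 := by rw [hΩδ]; exact mul_ne_zero hιδ hΩ'
  have h𝔪1 : 𝔪 ≠ ⊤ := fun h => hπ₀𝔪 0 (by rw [h]; exact Submodule.mem_top)
  have h𝔪'1 : 𝔪' ≠ ⊤ := fun h => hπ₀𝔪' 0 (by rw [h]; exact Submodule.mem_top)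
  -- ### the unit `c = δ_v`
  obtain ⟨c, hcK, hce⟩ := exists_tateUnit_reading_of_not_mem (K := K) he hf hδv
  -- ### the side conditions of the `δ`-datum from the two presentations
  have hCM : ∀ l ∈ L.lattice, ι (δ : K) * l ∈ L.lattice := fun l hl => isCMLattice_of_model ι hL δ l hl
  have hΩ'L : Ω' ∉ L.lattice := notMem_lattice_of_model ι hL' hΩ' h𝔪'1
  have hδΩ'L : ι (δ : K) * Ω' ∉ L.lattice := by rw [← hΩδ]; exact notMem_lattice_of_model ι hL hΩ h𝔪1
  have h2𝔪' : (2 : 𝓞 K) ∉ 𝔪' := fun h => h2𝔪 (hle h)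
  have h2Ω' : (2 : ℂ) * Ω' ∉ L.lattice := by
    have h := mul_gen_notMem ι hL' hΩ' h2𝔪'
    rwa [show ι ((2 : 𝓞 K) : K) = (2 : ℂ) by exact map_ofNat ι 2] at h
  have h2Ωδ : (2 : ℂ) * (ι (δ : K) * Ω') ∉ L.lattice := by
    have h := mul_gen_notMem ι hL hΩ h2𝔪
    rwa [show ι ((2 : 𝓞 K) : K) = (2 : ℂ) by exact map_ofNat ι 2, hΩδ] at h
  -- ### representatives of `δ⁻¹Λ/Λ` and the readings of their x-coordinates
  obtain ⟨S, hS0, hS, hSd⟩ := L.exists_reps_of_mul_mem hιδ hCM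
  have hXc : ∀ c' : ℂ, ∃ X : readingRing E hEr, c' ∈ S.erase 0 →
      algClosureEmb ι (((algebraMap (rayClassField K 𝔪r) (AlgebraicClosure K)).comp (readingRing E hEr).subtype) X) =
        ℘[L] c' - (W.baseChange ℂ).b₂ / 12 := by
    intro c'
    by_cases hc' : c' ∈ S.erase 0
    · have hcS : c' ∈ S := Finset.mem_of_mem_erase hc'
      have hc0 : c' ≠ 0 := Finset.ne_of_mem_erase hc'
      have h1 : ι (δ : K) * c' ∈ L.lattice := (hS c').mpr ⟨c', hcS, by rw [sub_self]; exact L.lattice.zero_mem⟩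
      have h2 : c' ∉ L.lattice := fun h => hc0 (by
        have := hSd c' hcS 0 hS0 (by rw [sub_zero]; exact h); exact this)
      obtain ⟨X, hXi, hX⟩ := hXδ c' h1 h2
      exact ⟨⟨X, hXi⟩, fun _ => hX⟩
    · exact ⟨0, fun h => (hc' h).elim⟩
  choose Xc hXc using hXc
  -- ### `α_R = δ`, `δ⁻¹` in `R`
  have hφK : ∀ (t : K) (ht : algebraMap K (rayClassField K 𝔪r) t ∈ readingRing E hEr),
      algClosureEmb ι (((algebraMap (rayClassField K 𝔪r) (AlgebraicClosure K)).comp (readingRing E hEr).subtype)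
        ⟨algebraMap K (rayClassField K 𝔪r) t, ht⟩) = ι t := fun t ht => by
    change algClosureEmb ι (algebraMap (rayClassField K 𝔪r) (AlgebraicClosure K) (algebraMap K (rayClassField K 𝔪r) t)) = ι t
    rw [← IsScalarTower.algebraMap_apply, algClosureEmb_algebraMap]
  have hαi : algebraMap K (rayClassField K 𝔪r) (δ : K) ∈ readingRing E hEr := by
    refine mem_readingRing_of_isIntegral E hEr ?_
    change IsIntegral ℤ (algebraMap K (AlgebraicClosure K) (δ : K))
    exact (RingOfIntegers.isIntegral_coe δ).algebraMap
  have hαinvi : algebraMap K (rayClassField K 𝔪r) ((δ : K)⁻¹) ∈ readingRing E hEr := by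
    refine algebraMap_mem_readingRing_of_mem_integer E hEr ?_
    have h1 : ((c : 𝒪[(v.adicCompletion K)]) : v.adicCompletion K) *
        (((c⁻¹ : 𝒪[(v.adicCompletion K)]ˣ) : 𝒪[(v.adicCompletion K)]) : v.adicCompletion K) = 1 := by
      rw [← Subring.coe_mul, Units.mul_inv, Subring.coe_one]
    rw [map_inv₀, ← hcK, ← eq_inv_of_mul_eq_one_right h1]
    exact ((c⁻¹ : 𝒪[(v.adicCompletion K)]ˣ) : 𝒪[(v.adicCompletion K)]).2
  have hδK : (δ : K) ≠ 0 := by exact_mod_cast hδ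
  have hinv : (⟨algebraMap K (rayClassField K 𝔪r) (δ : K), hαi⟩ : readingRing E hEr) *
      ⟨algebraMap K (rayClassField K 𝔪r) ((δ : K)⁻¹), hαinvi⟩ = 1 := by
    apply Subtype.ext
    change algebraMap K (rayClassField K 𝔪r) (δ : K) * algebraMap K (rayClassField K 𝔪r) ((δ : K)⁻¹) = 1
    rw [← map_mul, mul_inv_cancel₀ hδK, map_one]
  have hαj := hφK (δ : K) hαi
  -- ### the `δ`-CM datum over `R := readingRing E hEr`
  obtain ⟨T, Pr, Qr, PC, QC, hT0, hTP, -, hT, hQC, hs, hQr, hPr, hidX, hidY⟩ :=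
    exists_deltaDatum_readingRing he hf ι E hEr hq hπ heπ hA hP hPexp W hW hδ hce.symm c rfl L h₂ h₃ hCM hΩ'L hδΩ'L h2Ω' h2Ωδ
      S hS0 hS hSd ⟨X₀, hX₀i⟩ ⟨Y₀, hY₀i⟩ ⟨X₁, hX₁i⟩ ⟨Y₁, hY₁i⟩ _ _ hinv hX₀ hY₀ (by rw [← hΩδ]; exact hX₁) (by rw [← hΩδ]; exact hY₁)
      hαj Xc hXc
  -- ### the transport
  refine ⟨c, hcK, tateUnit_eq_mul_of_lane _ hq hπ heπ hP W E ι L h₂ h₃ hL hL' hle hδ hΩ' hΩδ hβ hβ' hv0 h2K hprime hπ₁ hπ₀𝔪 hπ₀𝔪'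
    (readingHom E hEr) ((algebraMap (rayClassField K 𝔪r) (AlgebraicClosure K)).comp (readingRing E hEr).subtype)
    (fun r => coe_coe_readingHom E hEr r) hαj c hT0 hTP hT hQC hs hQr hPr hidX hidY hX₀ hY₀ ?_ ?_ h6 h𝔑 hv𝔑 h𝔑ψ hα0 hα𝔑 hαw hαπ
    hdegE xu yu xu' yu' XU YU XU' YU' hxu hyu hXU hYU hxu' hyu' hXU' hYU' ha ha'⟩
  · rw [hαj, ← hΩδ]; exact hX₁
  · rw [hαj, ← hΩδ]; exact hY₁

/-! ## §3 The level constant -/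

/-- **The level constant is level-independent** (bookkeeping of [I4]): over any commutative ring `A`, if `a = c·a′` in `𝒪_vˣ`,
`c = δ_v`, `μ′ = δ·μ` in `K` and the reading `φ_F` of `K_v` restricts on `K` to `Φ`, then `φ_F(a)·Φ(μ) = φ_F(a′)·Φ(μ′)` — with
`φ_F := θ ∘ (K_v → ℂ_v)`, `Φ := ι⁻¹ ∘ w₀` this is `A_M = A_{M′}` for `A_M := θ(a_M)·ι⁻¹(w₀ μ_M)`, `Ω_M = Ω_E/ι(μ_M)`,
`δ = μ_{M′}/μ_M`. [cite: deShalit1987, II §4.14 (38) (p. 71)] -/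
theorem levelConstant_eq_of_tateUnit_eq_mul {A : Type*} [CommRing A] (φF : v.adicCompletion K →+* A) (Φ : K →+* A)
    (hφK : ∀ k : K, φF (algebraMap K (v.adicCompletion K) k) = Φ k) {a a' c : 𝒪[(v.adicCompletion K)]ˣ} {δ μ μ' : K}
    (hac : a = c * a') (hc : ((c : 𝒪[(v.adicCompletion K)]) : v.adicCompletion K) = algebraMap K (v.adicCompletion K) δ)
    (hμ : μ' = δ * μ) :
    φF (((a : 𝒪[(v.adicCompletion K)]ˣ) : 𝒪[(v.adicCompletion K)]) : v.adicCompletion K) * Φ μ =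
      φF (((a' : 𝒪[(v.adicCompletion K)]ˣ) : 𝒪[(v.adicCompletion K)]) : v.adicCompletion K) * Φ μ' := by
  rw [hac, Units.val_mul, Subring.coe_mul, map_mul, hc, hφK, hμ, map_mul]
  ring

end Summit.BirchSwinnertonDyer.BirchSwinnertonDyer.Theorems.PrintCf2.KatzMeasureJZeroSeam

end
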